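import Literature.AlgebraicGeometry.HodgeTheory.SemiregularReducedObstructions
import Literature.AlgebraicGeometry.HodgeTheory.SemiregularVariationalHodgeTwistedPerfect
import Literature.AlgebraicGeometry.HodgeTheory.HomComplexSigmaSingle
import Literature.AlgebraicGeometry.Modules.StrictlyPerfectResolution
import HarnessLib

/-!
# Pridham 2024 (Forum Math. Sigma 12, e126), Cor. 2.25 and Remark 2.27 for PERFECT COMPLEXES: the semiregularity
# map of a strictly perfect complex kills every obstruction to its derived deformations along the Hodge locus —
# INFINITESIMAL form, on the Literature carrier `HomComplex.IsISemiregularC`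

Family `hodge`, layer `Literature/AlgebraicGeometry/HodgeTheory`. ONE NAMED FACT (D-0014), grade **REFEREED**
(Forum Math. Sigma 12 (2024) e126, doi:10.1017/fms.2024.132), the PERFECT-COMPLEX sibling of the finite-locally-free
rendering `Pridham2024_ISemiregular_liftsOverHodgeLocus_model` (`SemiregularReducedObstructions.lean`, whose module
docstring lists «Perfect complexes […]: no real carrier for the Atiyah class / `σ` of a complex» under «What is NOT
rendered»). That carrier now exists in this layer: `HomComplex.sigmaC` / `HomComplex.IsISemiregularC X₀ E a b hE I`
(`HomComplexSigma.lean`, the semiregularity map `σ_q = Tr(∗ · At(E•)^q)` of a bounded complex `E•` of finite locally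
free modules, [BuchweitzFlenner2003, Def. 4.1] without the units `(-1)^q/q!`), together with the Chern character
`chPerfect C X₀ E hE p` of such a complex (`SemiregularVariationalHodgeTwistedPerfect.lean` §1). Typed by the LT-H1
literature seat `hodge-lit-semireg-typer` (cell `pub-hsemireg`, tranche «SEMIREGULARITY CONSUMERS», item (c) «the
semiregularity map annihilates ALL obstructions — say exactly which objects: modules, perfect complexes»): the module row
is `BandieraLepriManetti2023_semiregularityMap_annihilatesObstructions` / `Pridham2024_ISemiregular_liftsOverHodgeLocus_model`,
this file is the perfect-complex row. The SAME statement, binder for binder, was typed earlier on the venture side of the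
tree as the HYPOTHESIS BY NAME `Summit.Ventures.HSemireg.PridhamPerfectLifts C` (`AmplificationChainPridhamPerfect.lean`,
«NOT a Literature fact (carrier location)»); with the carrier promoted, the statement is vendored here with its source, and
the venture predicate `PerfectLiftsOverArtinianPointsAt` is re-homed verbatim (§1) so that summit-side files can be
re-pointed (`Iff.rfl`). Cell words (seats, ventures) are provenance only. Nothing here asserts HC / HC_AV / any seed.

## Source, verbatim [corpus: cell text `pub-hsemireg/theory/th1-perry/Pridham2024-FMS-e126-text/`, PUBLISHED numbering]

* **Cor. 2.25** (p0019:L44–56): «Take a local Artinian simplicial ℂ-algebra `A`, a derived Artin `n`-stack `X` over `A`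
  whose underived truncation is locally of finite type, and a square-zero simplicial ideal `I ⊂ A` with quotient
  `e : A → B`. Then for any perfect complex `ℱ` over `X′ := X ⊗^L_A B`, with `o_e(ℱ) ∈ Ext²_{𝒪_{X′}}(ℱ, ℱ ⊗_B I)` the
  obstruction to deforming `ℱ` to an `𝒪_X`-module in complexes, the image of the Chern character `ch_p(ℱ)` under the map
  `H^{2p}(|X′(ℂ)_an|, ℚ) ≃ H^{2p}(|X(ℂ)_an|, ℚ) → H^{2p}(|X(ℂ)_an|, A) ≃ H^{2p}(LDR(X/A))` lies in `F^p H^{2p}(LDR(X/A))` if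
  and only if the image of `𝓛_{p−1}(o_e(ℱ))` under the map `H^{p+1}(X, LΩ^{p−1}_{X/A} ⊗^L_A I) → H^{2p}(X, Tot^Π(LΩ^{<p}_{X/A}, d))`,
  coming from the inclusion `I ↪ A`, is zero.» (Intro Theorem, p0002:L39–53: the same for «a smooth morphism
  `X → Spec A`», «any perfect complex `ℱ` over `X′ := X ⊗_A B`», with `σ_{p−1}`; p0003:L1–3: «if the family `X` is constant
  over `A` […] the obstruction `o(ℱ)` always maps to zero (Remark 2.23)».)
* **Rem. 2.27** (p0020:L28–57): «Assume that `R` is a Noetherian ℚ-algebra, with `X` a smooth proper scheme over `Spec R`.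
  […] the map `H^{p+1}(X, Ω^{p−1}_{X/R} ⊗_R I) → H^{2p}(X, (DR(𝒪_X/R)/F^p) ⊗_R A)` is therefore injective. […] In the case
  where `X` is a smooth proper scheme over an Artinian ℂ-algebra, vanishing of `𝓛_{p−1}(o_e(ℱ))` itself is thus equivalent
  to the conditions of Corollary 2.25 (taking `R = A`), which we can paraphrase as saying that `𝓛_{p−1}(o_e(ℱ))` is the
  obstruction to the unique horizontal lift of `ch^dR_p(ℱ)` still lying in `F^p H^{2p} DR(X/A)`, or equivalently remaining of
  pure Hodge type `(p,p)`. Taking an open substack `𝔐 ⊂ Perf_X` for which that obstruction vanishes at all points `[ℱ]` (for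
  instance, by restricting to the Hodge locus of [Voi]), we then have a functorial obstruction theory
  `([ℱ] ∈ 𝔐(B)) ↦ ker(𝓛_{p−1} : Ext²_{𝒪_{X_B}}(ℱ, ℱ ⊗^L_B −) → H^{p+1}(X, Ω^{p−1}_{X/R}) ⊗^L_R −)` for `𝔐` as a subspace
  of the standard obstruction theory.»
* **Rem. 2.21** (p0018:L2–5): «[BF2, Theorem 5.1.3 and Proposition 6.2.1] ensure that `𝓛` is the same as the
  semiregularity map `σ` of [BF1], given by applying the exponential of the Atiyah class then taking the trace.»
* **Lemma 1.8** (p0007:L15–27): «a functorial obstruction `o_e(x) ∈ D¹_x(F, I)`, which is zero if and only if `[x]` lies in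
  the image of `e_* : π_0(FA) → π_0(FB)`»; **Lemma 1.9** (p0007:L48–52): «The functor `Perf_X` is homotopy-preserving and
  homotopy-homogeneous […] `D^i_ℱ(Perf_X, M) ≃ Ext^{i+1}(ℱ, ℱ ⊗_A M)`.»

## Rendering (every binder a printed hypothesis or a strengthening of one) and grade

Binders = those of `Pridham2024_ISemiregular_liftsOverHodgeLocus_model` VERBATIM (a Chern character theory `C`; a smooth
projective family `π : 𝒳 ⟶ S` of relative dimension `n` over a SMOOTH `ℂ`-scheme `S` — Rem. 2.27's «`R` Noetherian
ℚ-algebra, `X` a smooth proper scheme over `Spec R`» on every affine chart; a cohomologically locally trivial `U ∋ s₀`; a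
model `e : X₀ ≅ 𝒳_{s₀}`), with THREE replacements: the sheaf `E₀` becomes a cochain complex `E` of `𝒪_{X₀}`-modules
concentrated in `[a, b]` with every term finite locally free (a STRICTLY PERFECT complex — «perfect complex `ℱ`»; on the
projective `X₀` every perfect complex has such a representative); `IsISemiregular hE₀ {q | q+1 ∈ I}` becomes
`HomComplex.IsISemiregularC X₀ E a b hE {q | q + 1 ∈ I}` — JOINT INJECTIVITY of `(σ_q)_{q+1 ∈ I}` on
`Ext²(E, E) = Hom_{D(X₀)}(Q E, (Q E)⟦2⟧)` in Mathlib's derived category of all `𝒪_{X₀}`-modules (constructed instance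
`HasDerivedCategory.standard`) — «`ker 𝓛_{p−1}` as obstruction theory» with `𝓛 = σ` (Rem. 2.21), zero kernel; `C.ch X₀ E₀ p`
becomes `chPerfect C X₀ E hE p`; and the HODGE-LOCUS hypothesis is rendered on the base exactly as in the sibling («restricting
to the Hodge locus of [Voi]»: the transports of `(e⁻¹)^* ch_p(E)` along all paths in `U` are of type `(p, p)`, `p ∈ I`).
CONCLUSION: the DERIVED small-extension lifting property `PerfectLiftsOverArtinianPointsAt π s₀ X₀ e E` (§1): for every
local Artinian ℂ-algebra `A`, every small extension `f : A ↠ B` (`𝔪_A · ker f = 0`, in particular square-zero), every ℂ-point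
`ρ` of `B`, every `A`-point of `S` centred at `s₀`, every choice of the base changes `X_A`, `X_B` and of the closed fibre
`j : X₀ ⟶ X_B` compatible with `e`, every bounded complex of vector bundles `F` on `X_B` with `Q(j^*F) ≅ Q(E)` in `D(X₀)` admits
a bounded complex of vector bundles `G` on `X_A` with `Q(i^*G) ≅ Q(F)` in `D(X_B)` («`[ℱ]` lies in the image of
`e_* : π_0(Perf_{X_A}) → π_0(Perf_{X_B})`», Lemma 1.8–1.9). GRADE: **REFEREED**. FAITHFULNESS: WEAKER than print (special
case: smooth projective SCHEMES over a smooth base, strictly perfect representatives, small extensions, Hodge hypothesis on the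
reduced base) — never stronger. The three standard sentences between print and rendering are (G-a) and (G-b) of the sibling's
module docstring, read for the termwise-flat strictly perfect `F` (`Lj^*F = j^*F`, adjunction `Lj^* ⊣ j_*`, base change of
the Atiyah class and of the trace: `σ_{X_B/B}(F) = σ_{X₀}(E) ⊗ id_I` on `Ext²_{X_B}(F, F ⊗_B I) ≅ Ext²_{X₀}(E, E) ⊗ I`,
[BuchweitzFlenner2003, Rem. 4.7 (1)]), and (G-c′): Lemma 1.8–1.9 give a PERFECT lift `G′` on `X_A` with `G′ ⊗^L_A B ≃ F`,
and `X_A`, projective over the affine `Spec A`, has the resolution property, so `G′` is quasi-isomorphic to a bounded complex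
`G` of vector bundles [ThomasonTrobaugh1990, Prop. 2.3.1 (d)] (text not held in the corpus; standard), with `Li^*G = i^*G`.
SCALARS: the carrier's `σ_q` omits `(-1)^q/q!` — units over `ℂ`, same kernel.

## Faithfulness sheet (one line per declaration)

| declaration | vs. print | note |
|---|---|---|
| `PerfectLiftsOverArtinianPointsAt` | FAITHFUL (vocabulary) | Lemma 1.8's «`[x] ∈ im e_*`» for `F = Perf_X`, strictly perfect representatives, iso in `D`, not of complexes |
| `Pridham2024_ISemiregular_liftsOverHodgeLocus_perfect` | WEAKER (special case), REFEREED | the one named fact |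
| `…_perfect_finset`, `Pridham2024_semiregular_liftsOverHodgeLocus_perfect`, `…_perfect_iff` | PROVED repackagings | `I : Finset ℕ` (= the venture's `PridhamPerfectLifts C` telescope); FULL `σ`; `Iff.rfl` |
| `….perfectLifts_single₀` | PROVED | the sheaf-shaped hypotheses (`IsISemiregular hE₀`, `C.ch X₀ E₀`) feed the fact at `E = E₀[0]` via the agreement `HomComplex.isISemiregularC_single₀_iff` and `chPerfect_single` |
| `perfectLiftsOverArtinianPointsAt_iff_of_iso`, `….perfectLifts_resolution`, `….perfectLifts_coherent` (§5) | PROVED | the conclusion depends on `E` only through `Q E`; the COHERENT-SHEAF form («perfect complex `ℱ`» ⊇ coherent sheaves on the smooth `X₀`, via a strictly perfect resolution `R` — `σ` of the perfect complex `ℰ_0`, as in [BuchweitzFlenner2003] §5) is the fact at `E = R.P`, transported to `ℰ_0[0]` along `Q(R.ε)` |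

RELATION TO THE SHEAF FACT (honest): on the overlap `E = E₀[0]` the HYPOTHESES agree (§4, proved); the CONCLUSIONS
`LiftsOverArtinianPointsAt … E₀` (vector-bundle lifts of vector bundles) and `PerfectLiftsOverArtinianPointsAt … E₀[0]`
(derived lifts of strictly perfect complexes quasi-isomorphic to `E₀[0]`) are related in print by Nakayama along the
square-zero ideal ((G-c) of the sibling: a perfect `A`-lift of a vector bundle is a vector bundle in degree `0`), which is NOT a
kernel theorem of the tree: in the kernel the two facts are INCOMPARABLE, neither is claimed to imply the other.

## What is NOT here

`Ext^{<0}(E, E) = 0` (not a hypothesis of Cor. 2.25; it enters only the algebraisation step of a consumer — Lieblich's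
universally gluable complexes — which is NOT this file); μ_r-twisted objects (Rem. 2.26: no gerbe carrier); the ⟹-direction
of Cor. 2.25 and the identity `𝓛_{p−1}(o_e(ℱ)) = 0` (no obstruction class of a complex in the tree; the rendering keeps the
consequence «jointly injective ⟹ lifts»); derived / Artin-stack bases; any algebraisation («formally smooth ⟹ étale
neighbourhood», [Lieblich2006] 4.2.1 / [Perry2022] Prop. 8.1); any claim about any explicit variety or class.

## References

* [Pridham2024Semiregularity] J. P. Pridham, Forum Math. Sigma 12 (2024) e126: Cor. 2.25, Rem. 2.27, Rem. 2.21, Rem. 2.23,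
  Lemma 1.8–1.9, Intro Theorem p. 2.
* [BuchweitzFlenner2003] R.-O. Buchweitz, H. Flenner, Compositio Math. 137 (2003): Def. 4.1, §5 (I-semiregular), Rem. 4.7 (1).
* [Deligne1968] P. Deligne, Publ. Math. IHÉS 35 (1968), Thm. 5.5 ((G-a)).
* [ThomasonTrobaugh1990] R. W. Thomason, T. Trobaugh, in: The Grothendieck Festschrift III (1990), Prop. 2.3.1 (d) ((G-c′)).
-/

noncomputable section

open CategoryTheory AlgebraicGeometry
open _root_.Topology _root_.Filter
open Literature.AlgebraicTopology.SingularHomology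
open Literature.AlgebraicGeometry.KTheory

namespace Literature.AlgebraicGeometry.HodgeTheory

open Literature.AlgebraicGeometry.Motives

/-! ### §1 The derived small-extension lifting predicate of a cochain complex on the model fibre -/

/-- **The DERIVED small-extension lifting property of a cochain complex `E` on the model `X₀ ≅ 𝒳_{s₀}`** (PREDICATE —
a definition, nothing asserted; Literature home of the venture declaration `Summit.Ventures.HSemireg.PerfectLiftsOverArtinianPointsAt`,
same body): for every local Artinian `ℂ`-algebra `A`, every SMALL extension `f : A ↠ B` (`𝔪_A · ker f = 0`), every `ℂ`-point `ρ`
of `B`, every `A`-point `a` of `S` centred at `s₀`, every choice of the base changes `X_A = 𝒳 ×_S Spec A`, `X_B = X_A ×_A Spec B`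
and of the closed fibre `j : X₀ ⟶ X_B` compatible with `e` (three `IsPullback` squares, one equation — VERBATIM the telescope of
the sheaf-level `LiftsOverArtinianPointsAt`), every bounded complex of vector bundles `F` on `X_B` whose termwise (= derived,
the terms being flat) restriction `j^*F` is isomorphic to `E` IN THE DERIVED CATEGORY `D(Mod 𝒪_{X₀})` (Mathlib's
`DerivedCategory`, constructed instance `HasDerivedCategory.standard`) admits a bounded complex of vector bundles `G` on `X_A`
with `i^*G ≅ F` in `D(Mod 𝒪_{X_B})` — «`[F]` lies in the image of `e_* : π₀(Perf_{X_A}) → π₀(Perf_{X_B})`» for strictly perfect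
representatives. An on-the-nose (complex-level) lifting statement would be a different, generally false, predicate.
[cite: Pridham2024Semiregularity, Lemma 1.8–1.9 (the shape of the conclusion)] [cite: ThomasonTrobaugh1990, Prop. 2.3.1 (d)] -/
def PerfectLiftsOverArtinianPointsAt {𝒳 S : SchemeOver ℂ} (π : 𝒳 ⟶ S) (s₀ : ComplexPoints S) (X₀ : SchemeOver ℂ)
    (e : X₀ ≅ fiberOver π s₀) (E : CochainComplex X₀.left.Modules ℤ) : Prop :=
  ∀ (A B : Type) [CommRing A] [Algebra ℂ A] [IsArtinianRing A] [IsLocalRing A]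
    [CommRing B] [Algebra ℂ B] (f : A →ₐ[ℂ] B), Function.Surjective f →
    IsLocalRing.maximalIdeal A * RingHom.ker f = ⊥ →
    ∀ (ρ : B →ₐ[ℂ] ℂ) (a : specOver ℂ A ⟶ S),
      Spec.map (CommRingCat.ofHom (ρ.comp f).toRingHom) ≫ a.left = s₀.left →
      ∀ ⦃XA XB : Scheme⦄ (gA : XA ⟶ 𝒳.left) (qA : XA ⟶ Spec (.of A)),
        IsPullback gA qA π.left a.left →
        ∀ (i : XB ⟶ XA) (qB : XB ⟶ Spec (.of B)),
          IsPullback i qB qA (Spec.map (CommRingCat.ofHom f.toRingHom)) →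
          ∀ (j : X₀.left ⟶ XB),
            IsPullback j X₀.hom qB (Spec.map (CommRingCat.ofHom ρ.toRingHom)) →
            j ≫ i ≫ gA = e.hom.left ≫ (fiberι π s₀).left →
            ∀ (F : CochainComplex XB.Modules ℤ), IsBoundedVBComplex F →
              (letI := HasDerivedCategory.standard X₀.left.Modules
               Nonempty (DerivedCategory.Q.obj
                  (((Scheme.Modules.pullback j).mapHomologicalComplex (ComplexShape.up ℤ)).obj F) ≅
                 DerivedCategory.Q.obj E)) →
              ∃ (G : CochainComplex XA.Modules ℤ) (_ : IsBoundedVBComplex G),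
                letI := HasDerivedCategory.standard XB.Modules
                Nonempty (DerivedCategory.Q.obj
                    (((Scheme.Modules.pullback i).mapHomologicalComplex (ComplexShape.up ℤ)).obj G) ≅
                  DerivedCategory.Q.obj F)

/-! ### §2 The named fact -/

/-- **Pridham 2024, Cor. 2.25 with Rem. 2.27 (reduced obstruction theory on the Hodge locus), Rem. 2.21 (`𝓛 = σ`) and
Lemma 1.8–1.9 — PERFECT COMPLEXES (strictly perfect representatives), special fibre up to a model isomorphism,
infinitesimal form.** Printed (Cor. 2.25, p0019:L44–56; Intro Theorem p0002:L39–53): «Take a local Artinian ℂ-algebra `A`,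
a smooth morphism `X → Spec A` […] and square-zero ideal `I ⊂ A` with quotient `B = A/I`. Then for any perfect complex `ℱ`
over `X′ := X ⊗_A B`, with obstruction `o(ℱ) ∈ Ext²_{𝒪_{X′}}(ℱ, ℱ ⊗_B I)` to deforming `ℱ` to a complex of `𝒪_X`-modules,
the image of the Chern character `ch_p(ℱ)` […] lies in `F^p H^{2p}(X, Ω^•_{X/A})` if and only if `o(ℱ)` maps to zero under
the composite map `Ext² —σ_{p−1}→ H^{p+1}(X, I Ω^{p−1}_{X/A}) → H^{2p}(X, Ω^{<p}_{X/A})`»; Rem. 2.27 (p0020:L28–57): for «`X` a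
smooth proper scheme over `Spec R`», `R` a Noetherian ℚ-algebra, the last map is injective, «vanishing of `𝓛_{p−1}(o_e(ℱ))`
itself is thus equivalent to the conditions of Corollary 2.25», and «restricting to the Hodge locus of [Voi] […] we then have a
functorial obstruction theory `[ℱ] ↦ ker(𝓛_{p−1} …)`»; Rem. 2.21 (p0018:L2–5): «`𝓛` is the same as the semiregularity map `σ`
of [BF1]»; Lemma 1.8 (p0007:L23–27): «`o_e(x)` […] is zero if and only if `[x]` lies in the image of
`e_* : π_0(FA) → π_0(FB)`» (for `F = Perf_X`: Lemma 1.9). RENDERING (module docstring; binders of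
`Pridham2024_ISemiregular_liftsOverHodgeLocus_model` with `E₀` ↦ a bounded complex `E` of vector bundles in degrees `[a, b]`,
`IsISemiregular` ↦ `HomComplex.IsISemiregularC X₀ E a b hE {q | q + 1 ∈ I}`, `C.ch X₀ E₀ p` ↦ `chPerfect C X₀ E hE p`,
conclusion ↦ `PerfectLiftsOverArtinianPointsAt`): for `π : 𝒳 ⟶ S` smooth projective of relative dimension `n` over a SMOOTH
`S`, `U ∋ s₀` cohomologically locally trivial, a model `e : X₀ ≅ 𝒳_{s₀}`, such an `E` with `(σ_q(E))_{q+1 ∈ I}` jointly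
injective and the transports of `(e⁻¹)^* ch_p(E)` of type `(p, p)` on `U` for every `p ∈ I` ⟹ `E` has the derived
small-extension lifting property at `s₀`. Grade: REFEREED; WEAKER than print (special case). Glue sentences (G-a), (G-b), (G-c′)
as in the module docstring. [cite: Pridham2024Semiregularity, Cor. 2.25; Rem. 2.27; Rem. 2.21; Lemma 1.8–1.9; Intro Theorem p. 2]
[cite: BuchweitzFlenner2003, Def. 4.1, §5 (I-semiregular) and Rem. 4.7 (1)] [cite: Deligne1968, Thm. 5.5] -/
def Pridham2024_ISemiregular_liftsOverHodgeLocus_perfect : Prop :=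
  ∀ (C : ChernCharacterBetti) ⦃𝒳 S : SchemeOver ℂ⦄ (π : 𝒳 ⟶ S) (n : ℕ),
    IsSmoothProjectiveFamily π n → _root_.AlgebraicGeometry.Smooth S.hom →
    ∀ ⦃U : Set (ComplexPoints S)⦄ (hU : IsCohomologicallyLocallyTrivialOn π U) (s₀ : U)
      (X₀ : SchemeOver ℂ) (e : X₀ ≅ fiberOver π s₀.1)
      (E : CochainComplex X₀.left.Modules ℤ) (a b : ℤ) (_ : E.IsStrictlyGE a) (_ : E.IsStrictlyLE b)
      (hE : ∀ i, IsFiniteLocallyFree (E.X i)) (I : Set ℕ),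
      (letI := HasDerivedCategory.standard X₀.left.Modules
       HomComplex.IsISemiregularC X₀ E a b hE {q | q + 1 ∈ I}) →
      (∀ p ∈ I, ∀ (t : U) (γ : Path.Homotopic.Quotient s₀ t),
          IsOfHodgeType n (fiberOver π t.1) (2 * p) p p
            (transportFun π (2 * p) hU γ (complexBetti.map e.inv (2 * p) (chPerfect C X₀ E hE p)))) →
      PerfectLiftsOverArtinianPointsAt π s₀.1 X₀ e E

/-! ### §3 Repackagings (PROVED) -/

/-- **The fact IS «hypotheses ⟹ `PerfectLiftsOverArtinianPointsAt`»** (definitional unfolding, for consumers that quote the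
telescope). [cite: Pridham2024Semiregularity, Cor. 2.25; Rem. 2.27; Lemma 1.8–1.9] -/
theorem Pridham2024_ISemiregular_liftsOverHodgeLocus_perfect_iff :
    Pridham2024_ISemiregular_liftsOverHodgeLocus_perfect ↔
      ∀ (C : ChernCharacterBetti) ⦃𝒳 S : SchemeOver ℂ⦄ (π : 𝒳 ⟶ S) (n : ℕ),
        IsSmoothProjectiveFamily π n → _root_.AlgebraicGeometry.Smooth S.hom →
        ∀ ⦃U : Set (ComplexPoints S)⦄ (hU : IsCohomologicallyLocallyTrivialOn π U) (s₀ : U)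
          (X₀ : SchemeOver ℂ) (e : X₀ ≅ fiberOver π s₀.1)
          (E : CochainComplex X₀.left.Modules ℤ) (a b : ℤ) (_ : E.IsStrictlyGE a) (_ : E.IsStrictlyLE b)
          (hE : ∀ i, IsFiniteLocallyFree (E.X i)) (I : Set ℕ),
          (letI := HasDerivedCategory.standard X₀.left.Modules
           HomComplex.IsISemiregularC X₀ E a b hE {q | q + 1 ∈ I}) →
          (∀ p ∈ I, ∀ (t : U) (γ : Path.Homotopic.Quotient s₀ t),
              IsOfHodgeType n (fiberOver π t.1) (2 * p) p p
                (transportFun π (2 * p) hU γ (complexBetti.map e.inv (2 * p) (chPerfect C X₀ E hE p)))) →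
          PerfectLiftsOverArtinianPointsAt π s₀.1 X₀ e E :=
  Iff.rfl

/-- **`Finset` form** (`I : Finset ℕ`): EXACTLY the binder telescope of the venture hypothesis
`Summit.Ventures.HSemireg.PridhamPerfectLifts C`, which therefore follows from the fact by this lemma (`Finset.mem_coe` is
`Iff.rfl`, so the `Set`-binders at `↑I` are the `Finset` ones definitionally).
[cite: Pridham2024Semiregularity, Cor. 2.25; Rem. 2.27; Rem. 2.21; Lemma 1.8–1.9] -/
theorem Pridham2024_ISemiregular_liftsOverHodgeLocus_perfect_finset
    (h : Pridham2024_ISemiregular_liftsOverHodgeLocus_perfect) (C : ChernCharacterBetti)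
    {𝒳 S : SchemeOver ℂ} (π : 𝒳 ⟶ S) (n : ℕ) (hπ : IsSmoothProjectiveFamily π n)
    (hS : _root_.AlgebraicGeometry.Smooth S.hom) {U : Set (ComplexPoints S)}
    (hU : IsCohomologicallyLocallyTrivialOn π U) (s₀ : U) (X₀ : SchemeOver ℂ) (e : X₀ ≅ fiberOver π s₀.1)
    (E : CochainComplex X₀.left.Modules ℤ) (a b : ℤ) (hGE : E.IsStrictlyGE a) (hLE : E.IsStrictlyLE b)
    (hE : ∀ i, IsFiniteLocallyFree (E.X i)) (I : Finset ℕ)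
    (hσ : letI := HasDerivedCategory.standard X₀.left.Modules
      HomComplex.IsISemiregularC X₀ E a b hE {q | q + 1 ∈ I})
    (hHodge : ∀ p ∈ I, ∀ (t : U) (γ : Path.Homotopic.Quotient s₀ t),
      IsOfHodgeType n (fiberOver π t.1) (2 * p) p p
        (transportFun π (2 * p) hU γ (complexBetti.map e.inv (2 * p) (chPerfect C X₀ E hE p)))) :
    PerfectLiftsOverArtinianPointsAt π s₀.1 X₀ e E :=
  h C π n hπ hS hU s₀ X₀ e E a b hGE hLE hE (↑I : Set ℕ) hσ (fun p hp => hHodge p (Finset.mem_coe.mp hp))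

/-- **The FULL-`σ` form**: with the whole semiregularity map injective (`IsISemiregularC … Set.univ`) and the transports of
`(e⁻¹)^* ch_p(E)` of type `(p, p)` on `U` in EVERY degree, the same derived lifting conclusion — the case `I = Set.univ`.
[cite: Pridham2024Semiregularity, Cor. 2.25; Rem. 2.27; Rem. 2.21; Lemma 1.8–1.9] -/
theorem Pridham2024_semiregular_liftsOverHodgeLocus_perfect
    (h : Pridham2024_ISemiregular_liftsOverHodgeLocus_perfect) (C : ChernCharacterBetti)
    {𝒳 S : SchemeOver ℂ} (π : 𝒳 ⟶ S) (n : ℕ) (hπ : IsSmoothProjectiveFamily π n)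
    (hS : _root_.AlgebraicGeometry.Smooth S.hom) {U : Set (ComplexPoints S)}
    (hU : IsCohomologicallyLocallyTrivialOn π U) (s₀ : U) (X₀ : SchemeOver ℂ) (e : X₀ ≅ fiberOver π s₀.1)
    (E : CochainComplex X₀.left.Modules ℤ) (a b : ℤ) (hGE : E.IsStrictlyGE a) (hLE : E.IsStrictlyLE b)
    (hE : ∀ i, IsFiniteLocallyFree (E.X i))
    (hσ : letI := HasDerivedCategory.standard X₀.left.Modules
      HomComplex.IsISemiregularC X₀ E a b hE Set.univ)
    (hHodge : ∀ (p : ℕ) (t : U) (γ : Path.Homotopic.Quotient s₀ t),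
      IsOfHodgeType n (fiberOver π t.1) (2 * p) p p
        (transportFun π (2 * p) hU γ (complexBetti.map e.inv (2 * p) (chPerfect C X₀ E hE p)))) :
    PerfectLiftsOverArtinianPointsAt π s₀.1 X₀ e E := by
  letI := HasDerivedCategory.standard X₀.left.Modules
  exact h C π n hπ hS hU s₀ X₀ e E a b hGE hLE hE Set.univ
    (HomComplex.IsISemiregularC.mono X₀ E (fun _ _ => Set.mem_univ _) hσ) (fun p _ => hHodge p)

/-! ### §4 Agreement with the sheaf-level hypotheses on the overlap `E = E₀[0]` (PROVED) -/

/-- **On a finite locally free sheaf placed in degree `0` the fact is fed by the SHEAF-level hypotheses**: for `E₀` finite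
locally free on `X₀` with the tree's module-level `IsISemiregular hE₀ {q | q + 1 ∈ I}` (`σ_q = Tr(∗ ∘ At^q)`,
`SemiregularityHigherSigma.lean`) and the Hodge hypothesis on `C.ch X₀ E₀ p`, the complex `E₀[0]` (`HomComplex.single₀`,
window `[0, 0]`) has the derived small-extension lifting property at `s₀`. The two hypothesis-side identifications are the
PROVED agreement `HomComplex.isISemiregularC_single₀_iff` (`σ_q^C(E₀[0]) = σ_q(E₀)` on `Ext²`) and `chPerfect_single`
(`ch_p(E₀[0]) = ch_p(E₀)`). The CONCLUSION here is the derived one; its relation to the vector-bundle conclusion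
`LiftsOverArtinianPointsAt … E₀` of the sheaf fact is Nakayama along the square-zero ideal, in print only (module docstring).
[cite: Pridham2024Semiregularity, Cor. 2.25; Rem. 2.27; Lemma 1.8–1.9]
[cite: BuchweitzFlenner2003, §4 (p. 165 L1–6: a module in degree 0 is a perfect complex) and §5 (I-semiregular)] -/
theorem Pridham2024_ISemiregular_liftsOverHodgeLocus_perfect.perfectLifts_single₀
    (h : Pridham2024_ISemiregular_liftsOverHodgeLocus_perfect) (C : ChernCharacterBetti)
    {𝒳 S : SchemeOver ℂ} (π : 𝒳 ⟶ S) (n : ℕ) (hπ : IsSmoothProjectiveFamily π n)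
    (hS : _root_.AlgebraicGeometry.Smooth S.hom) {U : Set (ComplexPoints S)}
    (hU : IsCohomologicallyLocallyTrivialOn π U) (s₀ : U) (X₀ : SchemeOver ℂ) (e : X₀ ≅ fiberOver π s₀.1)
    (E₀ : X₀.left.Modules) (hE₀ : IsFiniteLocallyFree E₀) (I : Set ℕ)
    (hsr : IsISemiregular hE₀ {q | q + 1 ∈ I})
    (hHodge : ∀ p ∈ I, ∀ (t : U) (γ : Path.Homotopic.Quotient s₀ t),
      IsOfHodgeType n (fiberOver π t.1) (2 * p) p p
        (transportFun π (2 * p) hU γ (complexBetti.map e.inv (2 * p) (C.ch X₀ E₀ p)))) :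
    PerfectLiftsOverArtinianPointsAt π s₀.1 X₀ e (HomComplex.single₀ X₀.left E₀) := by
  letI := HasDerivedCategory.standard X₀.left.Modules
  -- the terms of `E₀[0]` are finite locally free
  have hK : ∀ i, IsFiniteLocallyFree ((HomComplex.single₀ X₀.left E₀).X i) :=
    (IsBoundedVBComplex.single E₀ hE₀ 0).isFiniteLocallyFree
  -- `ch_p(E₀[0]) = ch_p(E₀)`
  have hch : ∀ p, chPerfect C X₀ (HomComplex.single₀ X₀.left E₀) hK p = C.ch X₀ E₀ p := fun p =>
    chPerfect_single C X₀ E₀ hE₀ hK p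
  -- complex-level `I`-semiregularity of `E₀[0]` in the window `[0, 0]` is the module-level one
  have hGE : (HomComplex.single₀ X₀.left E₀).IsStrictlyGE 0 :=
    inferInstanceAs (((CochainComplex.singleFunctor X₀.left.Modules 0).obj E₀).IsStrictlyGE 0)
  have hLE : (HomComplex.single₀ X₀.left E₀).IsStrictlyLE 0 :=
    inferInstanceAs (((CochainComplex.singleFunctor X₀.left.Modules 0).obj E₀).IsStrictlyLE 0)
  have hsrC : HomComplex.IsISemiregularC X₀ (HomComplex.single₀ X₀.left E₀) 0 0 hK {q | q + 1 ∈ I} :=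
    (HomComplex.isISemiregularC_single₀_iff X₀ E₀ hE₀ hK {q | q + 1 ∈ I}).2 hsr
  have key := h C π n hπ hS hU s₀ X₀ e (HomComplex.single₀ X₀.left E₀) 0 0 hGE hLE hK I hsrC
  simp only [hch] at key
  exact key hHodge

/-! ### §5 Resolution independence of the conclusion and the COHERENT-SHEAF form (PROVED) -/

section Coherent

open Literature.AlgebraicGeometry.Modules

variable {𝒳 S : SchemeOver ℂ} (π : 𝒳 ⟶ S) (s₀ : ComplexPoints S) (X₀ : SchemeOver ℂ) (e : X₀ ≅ fiberOver π s₀)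

/-- **The derived lifting predicate depends on `E` only through its image `Q E` in `D(Mod 𝒪_{X₀})`**: isomorphic objects of
the derived category (in particular quasi-isomorphic complexes, e.g. two strictly perfect resolutions of one coherent sheaf)
have the same small-extension lifting property — the predicate mentions `E` only in the clause «`Q(j^*F) ≅ Q(E)`».
[cite: Pridham2024Semiregularity, Lemma 1.8–1.9 (the functor `Perf_X` of perfect complexes up to equivalence)] -/
theorem perfectLiftsOverArtinianPointsAt_iff_of_iso {E E' : CochainComplex X₀.left.Modules ℤ}
    (φ : letI := HasDerivedCategory.standard X₀.left.Modules
      DerivedCategory.Q.obj E ≅ DerivedCategory.Q.obj E') :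
    PerfectLiftsOverArtinianPointsAt π s₀ X₀ e E ↔ PerfectLiftsOverArtinianPointsAt π s₀ X₀ e E' := by
  letI := HasDerivedCategory.standard X₀.left.Modules
  constructor
  · intro h A B _ _ _ _ _ _ f hf hsmall ρ a ha XA XB gA qA hA i qB hB j hj hje F hF hFE
    exact h A B f hf hsmall ρ a ha gA qA hA i qB hB j hj hje F hF ⟨hFE.some ≪≫ φ.symm⟩
  · intro h A B _ _ _ _ _ _ f hf hsmall ρ a ha XA XB gA qA hA i qB hB j hj hje F hF hFE
    exact h A B f hf hsmall ρ a ha gA qA hA i qB hB j hj hje F hF ⟨hFE.some ≪≫ φ⟩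

/-- **The fact at a strictly perfect RESOLUTION**: for an `𝒪_{X₀}`-module `ℰ_0` given with a strictly perfect resolution
`R` (`Modules.StrictlyPerfectResolution`: a bounded complex `R.P` of vector bundles in degrees `≤ 0` with a quasi-isomorphism
`R.ε : R.P ⟶ ℰ_0[0]`; on the smooth projective `X₀` every coherent sheaf has one), `I`-semiregularity of the PERFECT COMPLEX
`ℰ_0` — `(σ_q)_{q+1 ∈ I}` jointly injective on `Hom_{D(X₀)}(Q R.P, (Q R.P)⟦2⟧) = Ext²(ℰ_0, ℰ_0)` in some window `[a, 0]`, the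
hypothesis of `BuchweitzFlenner2003_variationalHodge_ISemiregular_coherent` verbatim — and the Hodge hypothesis on
`ch_p(R.P) = ch_p(ℰ_0)` give the derived lifting property of `R.P`. This is the fact at `E = R.P`, nothing more.
[cite: Pridham2024Semiregularity, Cor. 2.25; Rem. 2.27; Lemma 1.8–1.9] [cite: BuchweitzFlenner2003, §5 (I-semiregular coherent sheaf: σ of the perfect complex ℰ_0)] -/
theorem Pridham2024_ISemiregular_liftsOverHodgeLocus_perfect.perfectLifts_resolution
    (h : Pridham2024_ISemiregular_liftsOverHodgeLocus_perfect) (C : ChernCharacterBetti)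
    (n : ℕ) (hπ : IsSmoothProjectiveFamily π n) (hS : _root_.AlgebraicGeometry.Smooth S.hom) {U : Set (ComplexPoints S)}
    (hU : IsCohomologicallyLocallyTrivialOn π U) (s₀ : U) (e : X₀ ≅ fiberOver π s₀.1)
    (E₀ : X₀.left.Modules) (R : StrictlyPerfectResolution E₀) (I : Set ℕ)
    (hsr : ∃ (a : ℤ) (_ : R.P.IsStrictlyGE a),
      letI := HasDerivedCategory.standard X₀.left.Modules
      HomComplex.IsISemiregularC X₀ R.P a 0 R.isBoundedVB.isFiniteLocallyFree {q | q + 1 ∈ I})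
    (hHodge : ∀ p ∈ I, ∀ (t : U) (γ : Path.Homotopic.Quotient s₀ t),
      IsOfHodgeType n (fiberOver π t.1) (2 * p) p p
        (transportFun π (2 * p) hU γ
          (complexBetti.map e.inv (2 * p) (chPerfect C X₀ R.P R.isBoundedVB.isFiniteLocallyFree p)))) :
    PerfectLiftsOverArtinianPointsAt π s₀.1 X₀ e R.P := by
  letI := HasDerivedCategory.standard X₀.left.Modules
  obtain ⟨a, hGE, hσ⟩ := hsr
  exact h C π n hπ hS hU s₀ X₀ e R.P a 0 hGE R.isStrictlyLE R.isBoundedVB.isFiniteLocallyFree I hσ hHodge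

/-- **COHERENT-SHEAF form** («any perfect complex `ℱ`» ⊇ coherent sheaves on the smooth `X₀`): under the hypotheses of
`perfectLifts_resolution`, the complex `ℰ_0[0]` itself has the derived small-extension lifting property — transport along
the quasi-isomorphism `R.ε : R.P ⟶ ℰ_0[0]`, an isomorphism in `D(Mod 𝒪_{X₀})` (`perfectLiftsOverArtinianPointsAt_iff_of_iso`);
in particular the conclusion does not depend on the chosen resolution (and neither does the hypothesis:
`HomComplex.isISemiregularC_iff_of_roof`, `chPerfect_eq_of_quasiIso`). For `ℰ_0` finite locally free and `R = ℰ_0[0]`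
this is `perfectLifts_single₀`. [cite: Pridham2024Semiregularity, Cor. 2.25; Rem. 2.27; Lemma 1.8–1.9]
[cite: BuchweitzFlenner2003, §5 (I-semiregular coherent sheaf) and §4 (arXiv p. 20 L5–8: a module as a perfect complex)] -/
theorem Pridham2024_ISemiregular_liftsOverHodgeLocus_perfect.perfectLifts_coherent
    (h : Pridham2024_ISemiregular_liftsOverHodgeLocus_perfect) (C : ChernCharacterBetti)
    (n : ℕ) (hπ : IsSmoothProjectiveFamily π n) (hS : _root_.AlgebraicGeometry.Smooth S.hom) {U : Set (ComplexPoints S)}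
    (hU : IsCohomologicallyLocallyTrivialOn π U) (s₀ : U) (e : X₀ ≅ fiberOver π s₀.1)
    (E₀ : X₀.left.Modules) (R : StrictlyPerfectResolution E₀) (I : Set ℕ)
    (hsr : ∃ (a : ℤ) (_ : R.P.IsStrictlyGE a),
      letI := HasDerivedCategory.standard X₀.left.Modules
      HomComplex.IsISemiregularC X₀ R.P a 0 R.isBoundedVB.isFiniteLocallyFree {q | q + 1 ∈ I})
    (hHodge : ∀ p ∈ I, ∀ (t : U) (γ : Path.Homotopic.Quotient s₀ t),
      IsOfHodgeType n (fiberOver π t.1) (2 * p) p p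
        (transportFun π (2 * p) hU γ
          (complexBetti.map e.inv (2 * p) (chPerfect C X₀ R.P R.isBoundedVB.isFiniteLocallyFree p)))) :
    PerfectLiftsOverArtinianPointsAt π s₀.1 X₀ e (HomComplex.single₀ X₀.left E₀) := by
  letI := HasDerivedCategory.standard X₀.left.Modules
  haveI : QuasiIso R.ε := R.quasiIso
  exact (perfectLiftsOverArtinianPointsAt_iff_of_iso π s₀.1 X₀ e (asIso (DerivedCategory.Q.map R.ε))).1
    (h.perfectLifts_resolution π X₀ C n hπ hS hU s₀ e E₀ R I hsr hHodge)

end Coherent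

end Literature.AlgebraicGeometry.HodgeTheory

end
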